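import Mathlib
import HarnessLib
import Literature.MathematicalPhysics.QuantumFieldTheory.PointwiseOSReconstruction
import Summits.CriticalPhenomena.Ising3DConformalLimit.Theorems.ModularQuarterTurnDefs

/-!
# Toroidal (bispherical) coordinates about the rim circle: the geometry behind
`ModularQuarterTurn.ToroidalInversionUpgrade` (item stmt-CriticalPhenomena-6497)

For the route's parametrisation of `ℝ³` minus (rim circle ∪ `x₂`-axis) by a punctured-disc point
`(a, b)` (`0 < a² + b² < r²`) and a toroidal angle `ψ` — `Mf r (cos ψ) (sin ψ) a b`, conformal factor
`Jf` (`Theorems/ModularQuarterTurnDefs.lean`) — and the closed-form inverse chart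
`tf, af, bf, cf, sf, angf` of that file, we prove:
* FORWARD identities for `y` off the axis with `disc r y > 0`: `M_ψ(a,b) = y` (`Mf_cf_sf`),
  `M_{ψ+π}(a,b) = (r²/‖y‖²) · θ₂ y` (`Mf_neg_cf_neg_sf`; `θ₂ = axisReflection 2`, i.e. the half turn
  about the rim circle is the inversion in the sphere of radius `r` composed with `x₂ ↦ -x₂`) and
  `J(ψ+π) = J(ψ) · r²/‖y‖²` (`Jf_cf`, `Jf_neg_cf`);
* BACKWARD identities (`backward`): the closed forms recover the parameters from `M(c, s; a, b)`,
  whence injectivity of the parametrisation in `(cos ψ, sin ψ, a, b)`.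
Pure real algebra; no Ising input. References: Di Francesco–Mathieu–Sénéchal (1997) §4.1;
Hislop–Longo, Comm. Math. Phys. 84 (1982) §2.
-/

noncomputable section

open Literature.MathematicalPhysics.QuantumFieldTheory (axisReflection axisReflection_apply)

namespace Summit.CriticalPhenomena.Ising3DConformalLimit.ModularQuarterTurnToroidal

section Forward

variable {r : ℝ} {y : EuclideanSpace ℝ (Fin 3)}

/-- Core facts of the inverse toroidal map: positivity of `ρ`, `√disc`, `t ∈ (0,1)` and the two product
identities `t · 2rρ = A - √disc`, `t · (A + √disc) = 2rρ` (`A = ‖y‖² + r²`). [folklore] -/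
theorem core (hr : 0 < r) (hρ : 0 < y 0 ^ 2 + y 1 ^ 2) (hD : 0 < disc r y) :
    0 < rho y ∧ rho y ^ 2 = y 0 ^ 2 + y 1 ^ 2 ∧ 0 < Real.sqrt (disc r y) ∧
    Real.sqrt (disc r y) ^ 2 = disc r y ∧ 0 < tf r y ∧ tf r y < 1 ∧
    tf r y * (2 * r * rho y) = nsq y + r ^ 2 - Real.sqrt (disc r y) ∧
    tf r y * (nsq y + r ^ 2 + Real.sqrt (disc r y)) = 2 * r * rho y := by
  have hρpos : 0 < rho y := Real.sqrt_pos.2 hρ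
  have hρsq : rho y ^ 2 = y 0 ^ 2 + y 1 ^ 2 := Real.sq_sqrt hρ.le
  have hdpos : 0 < Real.sqrt (disc r y) := Real.sqrt_pos.2 hD
  have hdsq : Real.sqrt (disc r y) ^ 2 = disc r y := Real.sq_sqrt hD.le
  have hnsq : 0 ≤ nsq y := by unfold nsq; positivity
  have hAd : (nsq y + r ^ 2 - Real.sqrt (disc r y)) * (nsq y + r ^ 2 + Real.sqrt (disc r y)) =
      (2 * r * rho y) ^ 2 := by
    set d := Real.sqrt (disc r y) with hd
    have h : d ^ 2 = (nsq y - r ^ 2) ^ 2 + 4 * r ^ 2 * y 2 ^ 2 := hdsq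
    unfold nsq at h ⊢
    linear_combination (-1 : ℝ) * h - (4 * r ^ 2) * hρsq
  have hP : 0 < 2 * r * rho y := by positivity
  have hApd : 0 < nsq y + r ^ 2 + Real.sqrt (disc r y) := by positivity
  have hAmd : 0 < nsq y + r ^ 2 - Real.sqrt (disc r y) := by
    have h3 : 0 < (nsq y + r ^ 2 - Real.sqrt (disc r y)) * (nsq y + r ^ 2 + Real.sqrt (disc r y)) := by
      rw [hAd]; positivity
    by_contra h
    have h4 : (nsq y + r ^ 2 - Real.sqrt (disc r y)) * (nsq y + r ^ 2 + Real.sqrt (disc r y)) ≤ 0 :=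
      mul_nonpos_of_nonpos_of_nonneg (not_lt.1 h) hApd.le
    linarith
  have ht : tf r y = (nsq y + r ^ 2 - Real.sqrt (disc r y)) / (2 * r * rho y) := rfl
  have htpos : 0 < tf r y := by rw [ht]; positivity
  have htmul : tf r y * (2 * r * rho y) = nsq y + r ^ 2 - Real.sqrt (disc r y) := by
    rw [ht]; field_simp
  have htinv : tf r y * (nsq y + r ^ 2 + Real.sqrt (disc r y)) = 2 * r * rho y := by
    rw [ht, div_mul_eq_mul_div, div_eq_iff hP.ne']
    linear_combination hAd
  have htlt : tf r y < 1 := by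
    have hAP : 2 * r * rho y < nsq y + r ^ 2 + Real.sqrt (disc r y) := by
      nlinarith [mul_pos hApd hdpos]
    have : tf r y = 2 * r * rho y / (nsq y + r ^ 2 + Real.sqrt (disc r y)) := by
      rw [eq_div_iff hApd.ne']; exact htinv
    rw [this, div_lt_one hApd]
    exact hAP
  exact ⟨hρpos, hρsq, hdpos, hdsq, htpos, htlt, htmul, htinv⟩

/-- `cos² + sin² = 1` for the closed forms. [folklore] -/
theorem cf_sq_add_sf_sq (hD : 0 < disc r y) : cf r y ^ 2 + sf r y ^ 2 = 1 := by
  have hdpos : 0 < Real.sqrt (disc r y) := Real.sqrt_pos.2 hD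
  have hdsq : Real.sqrt (disc r y) ^ 2 = disc r y := Real.sq_sqrt hD.le
  unfold cf sf
  rw [div_pow, div_pow, ← add_div, div_eq_one_iff_eq (pow_pos hdpos 2).ne', hdsq]
  unfold disc
  ring

/-- The toroidal angle has the prescribed cosine. [folklore] -/
theorem cos_angf (hD : 0 < disc r y) : Real.cos (angf r y) = cf r y := by
  have h1 := cf_sq_add_sf_sq hD
  have hz : (⟨cf r y, sf r y⟩ : ℂ) ≠ 0 := by
    intro h
    have hc : cf r y = 0 := congrArg Complex.re h
    have hs : sf r y = 0 := congrArg Complex.im h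
    rw [hc, hs] at h1
    norm_num at h1
  have hn : ‖(⟨cf r y, sf r y⟩ : ℂ)‖ = 1 := by
    rw [Complex.norm_eq_sqrt_sq_add_sq]
    simp [h1]
  rw [angf, Complex.cos_arg hz, hn]
  simp

/-- The toroidal angle has the prescribed sine. [folklore] -/
theorem sin_angf (hD : 0 < disc r y) : Real.sin (angf r y) = sf r y := by
  have h1 := cf_sq_add_sf_sq hD
  have hn : ‖(⟨cf r y, sf r y⟩ : ℂ)‖ = 1 := by
    rw [Complex.norm_eq_sqrt_sq_add_sq]
    simp [h1]
  rw [angf, Complex.sin_arg, hn]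
  simp

/-- The toroidal angle lies in `(-π, π]`. [folklore] -/
theorem angf_mem (r : ℝ) (y : EuclideanSpace ℝ (Fin 3)) :
    -Real.pi < angf r y ∧ angf r y ≤ Real.pi :=
  ⟨Complex.neg_pi_lt_arg _, Complex.arg_le_pi _⟩

/-- The disc point of `y` lies at radius `r t`: `a² + b² = r² t²`. [folklore] -/
theorem af_sq_add_bf_sq (hr : 0 < r) (hρ : 0 < y 0 ^ 2 + y 1 ^ 2) (hD : 0 < disc r y) :
    af r y ^ 2 + bf r y ^ 2 = r ^ 2 * tf r y ^ 2 := by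
  obtain ⟨hρpos, hρsq, -, -, -, -, -, -⟩ := core hr hρ hD
  unfold af bf
  rw [div_pow, div_pow, ← add_div, div_eq_iff (pow_pos hρpos 2).ne', hρsq]
  ring

/-- The two denominators of `J` at the angles `ψ` and `ψ + π`:
`(1+t²) + (1-t²) cos ψ = 2 r t / ρ` and `(1+t²) - (1-t²) cos ψ = 2 t ‖y‖² / (r ρ)`. [folklore] -/
theorem denominators (hr : 0 < r) (hρ : 0 < y 0 ^ 2 + y 1 ^ 2) (hD : 0 < disc r y) :
    (1 + ((af r y ^ 2 + bf r y ^ 2) / r ^ 2)) + (1 - ((af r y ^ 2 + bf r y ^ 2) / r ^ 2)) * cf r y =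
      2 * r * tf r y / rho y ∧
    (1 + ((af r y ^ 2 + bf r y ^ 2) / r ^ 2)) + (1 - ((af r y ^ 2 + bf r y ^ 2) / r ^ 2)) * (-cf r y) =
      2 * tf r y * nsq y / (r * rho y) ∧
    (1 - ((af r y ^ 2 + bf r y ^ 2) / r ^ 2)) =
      2 * Real.sqrt (disc r y) * tf r y / (2 * r * rho y) := by
  obtain ⟨hρpos, hρsq, hdpos, hdsq, htpos, htlt, htmul, htinv⟩ := core hr hρ hD
  have hab := af_sq_add_bf_sq hr hρ hD
  have hτ : (af r y ^ 2 + bf r y ^ 2) / r ^ 2 = tf r y ^ 2 := by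
    rw [hab]; field_simp
  have hP : (0 : ℝ) < 2 * r * rho y := by positivity
  have h1 : 1 + tf r y ^ 2 = 2 * (nsq y + r ^ 2) * tf r y / (2 * r * rho y) := by
    rw [eq_div_iff hP.ne']
    linear_combination (tf r y) * htmul - htinv
  have h2 : 1 - tf r y ^ 2 = 2 * Real.sqrt (disc r y) * tf r y / (2 * r * rho y) := by
    rw [eq_div_iff hP.ne']
    linear_combination (-tf r y) * htmul - htinv
  refine ⟨?_, ?_, ?_⟩
  · rw [hτ, h1, h2]
    unfold cf
    field_simp
    ring
  · rw [hτ, h1, h2]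
    unfold cf
    field_simp
    ring
  · rw [hτ, h2]

/-- FORWARD IDENTITY for the conformal factor: `J(ψ) = ρ/(r t)` at the toroidal parameters of `y`.
[folklore] -/
theorem Jf_cf (hr : 0 < r) (hρ : 0 < y 0 ^ 2 + y 1 ^ 2) (hD : 0 < disc r y) :
    Jf r (cf r y) (af r y) (bf r y) = rho y / (r * tf r y) := by
  obtain ⟨hρpos, -, -, -, htpos, -, -, -⟩ := core hr hρ hD
  obtain ⟨hW, -, -⟩ := denominators hr hρ hD
  unfold Jf
  rw [hW]
  field_simp

/-- FORWARD IDENTITY for the conformal factor half a turn later: `J(ψ + π) = J(ψ) · r²/‖y‖²`.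
[folklore] -/
theorem Jf_neg_cf (hr : 0 < r) (hρ : 0 < y 0 ^ 2 + y 1 ^ 2) (hD : 0 < disc r y) :
    Jf r (-cf r y) (af r y) (bf r y) = rho y / (r * tf r y) * (r ^ 2 / nsq y) := by
  obtain ⟨hρpos, hρsq, -, -, htpos, -, -, -⟩ := core hr hρ hD
  obtain ⟨-, hW', -⟩ := denominators hr hρ hD
  have hnsq : 0 < nsq y := by unfold nsq; positivity
  unfold Jf
  rw [hW']
  field_simp

/-- FORWARD IDENTITY: the toroidal parametrisation at the closed-form parameters of `y` returns `y`.
[folklore] -/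
theorem Mf_cf_sf (hr : 0 < r) (hρ : 0 < y 0 ^ 2 + y 1 ^ 2) (hD : 0 < disc r y) :
    Mf r (cf r y) (sf r y) (af r y) (bf r y) = y := by
  obtain ⟨hρpos, hρsq, hdpos, hdsq, htpos, htlt, htmul, htinv⟩ := core hr hρ hD
  obtain ⟨-, -, hv⟩ := denominators hr hρ hD
  have hJ := Jf_cf hr hρ hD
  have hr0 : r ≠ 0 := hr.ne'
  have ht0 : tf r y ≠ 0 := htpos.ne'
  have hρ0 : rho y ≠ 0 := hρpos.ne'
  have hd0 : Real.sqrt (disc r y) ≠ 0 := hdpos.ne'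
  ext k
  fin_cases k
  · show (Mf r (cf r y) (sf r y) (af r y) (bf r y)) 0 = y 0
    simp only [Mf, PiLp.toLp_apply, Matrix.cons_val_zero, hJ]
    unfold af
    field_simp
  · show (Mf r (cf r y) (sf r y) (af r y) (bf r y)) 1 = y 1
    simp only [Mf, PiLp.toLp_apply, Matrix.cons_val_one, Matrix.cons_val_zero, hJ]
    unfold bf
    field_simp
  · show (Mf r (cf r y) (sf r y) (af r y) (bf r y)) 2 = y 2
    simp only [Mf, PiLp.toLp_apply, Matrix.cons_val_two, Matrix.tail_cons, Matrix.head_cons, hJ,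
      hv]
    unfold sf
    field_simp

/-- FORWARD IDENTITY half a turn later: `M_{ψ+π}(a, b) = (r²/‖y‖²) · θ₂ y` — the half turn about the
rim circle is the inversion in the sphere of radius `r` composed with the reflection `x₂ ↦ -x₂`.
[folklore] -/
theorem Mf_neg_cf_neg_sf (hr : 0 < r) (hρ : 0 < y 0 ^ 2 + y 1 ^ 2) (hD : 0 < disc r y) :
    Mf r (-cf r y) (-sf r y) (af r y) (bf r y) = (r ^ 2 / nsq y) • axisReflection 2 y := by
  obtain ⟨hρpos, hρsq, hdpos, hdsq, htpos, htlt, htmul, htinv⟩ := core hr hρ hD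
  obtain ⟨-, -, hv⟩ := denominators hr hρ hD
  have hJ := Jf_neg_cf hr hρ hD
  have hnsq : 0 < nsq y := by unfold nsq; positivity
  have hr0 : r ≠ 0 := hr.ne'
  have ht0 : tf r y ≠ 0 := htpos.ne'
  have hρ0 : rho y ≠ 0 := hρpos.ne'
  have hd0 : Real.sqrt (disc r y) ≠ 0 := hdpos.ne'
  have hn0 : nsq y ≠ 0 := hnsq.ne'
  ext k
  fin_cases k
  · show (Mf r (-cf r y) (-sf r y) (af r y) (bf r y)) 0 = ((r ^ 2 / nsq y) • axisReflection 2 y) 0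
    rw [PiLp.smul_apply, axisReflection_apply]
    simp only [Mf, PiLp.toLp_apply, Matrix.cons_val_zero, hJ, smul_eq_mul]
    unfold af
    rw [if_neg (by decide)]
    field_simp
  · show (Mf r (-cf r y) (-sf r y) (af r y) (bf r y)) 1 = ((r ^ 2 / nsq y) • axisReflection 2 y) 1
    rw [PiLp.smul_apply, axisReflection_apply]
    simp only [Mf, PiLp.toLp_apply, Matrix.cons_val_one, Matrix.cons_val_zero, hJ, smul_eq_mul]
    unfold bf
    rw [if_neg (by decide)]
    field_simp
  · show (Mf r (-cf r y) (-sf r y) (af r y) (bf r y)) 2 = ((r ^ 2 / nsq y) • axisReflection 2 y) 2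
    rw [PiLp.smul_apply, axisReflection_apply]
    simp only [Mf, PiLp.toLp_apply, Matrix.cons_val_two, Matrix.tail_cons, Matrix.head_cons, hJ,
      hv, smul_eq_mul, if_true]
    unfold sf
    field_simp

end Forward

section Backward

variable {r c s a b : ℝ}

/-- BACKWARD IDENTITIES: for parameters `c² + s² = 1`, `0 < a² + b² < r²`, the image point
`y = M(c, s; a, b)` lies off the `x₂`-axis and off the rim circle, and the closed forms recover the
parameters: `af y = a`, `bf y = b`, `cf y = c`, `sf y = s`.  Consequently the parametrisation is
injective in `(cos ψ, sin ψ, a, b)`. [folklore] -/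
theorem backward (hr : 0 < r) (hcs : c ^ 2 + s ^ 2 = 1) (hab : 0 < a ^ 2 + b ^ 2)
    (habr : a ^ 2 + b ^ 2 < r ^ 2) :
    0 < (Mf r c s a b) 0 ^ 2 + (Mf r c s a b) 1 ^ 2 ∧ 0 < disc r (Mf r c s a b) ∧
    af r (Mf r c s a b) = a ∧ bf r (Mf r c s a b) = b ∧
    cf r (Mf r c s a b) = c ∧ sf r (Mf r c s a b) = s := by
  set y := Mf r c s a b with hy
  set τ := (a ^ 2 + b ^ 2) / r ^ 2 with hτ
  have hr2 : 0 < r ^ 2 := by positivity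
  have hrne : r ≠ 0 := hr.ne'
  have hτ0 : 0 < τ := div_pos hab hr2
  have hτ1 : τ < 1 := (div_lt_one hr2).2 habr
  have h1τ : 0 < 1 - τ := by linarith
  have hτne : 1 - τ ≠ 0 := h1τ.ne'
  have hτr : τ * r ^ 2 = a ^ 2 + b ^ 2 := by rw [hτ]; field_simp
  set W := (1 + τ) + (1 - τ) * c with hW
  have hc1 : -1 ≤ c := by nlinarith [sq_nonneg s, sq_nonneg (c + 1)]
  have hWpos : 0 < W := by rw [hW]; nlinarith
  have hWne : W ≠ 0 := hWpos.ne'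
  have hJ : Jf r c a b = 2 / W := rfl
  have hy0 : y 0 = 2 / W * a := by
    simp only [hy, Mf, PiLp.toLp_apply, Matrix.cons_val_zero, hJ]
  have hy1 : y 1 = 2 / W * b := by
    simp only [hy, Mf, PiLp.toLp_apply, Matrix.cons_val_one, Matrix.cons_val_zero, hJ]
  have hy2 : y 2 = -(r / 2) * (1 - τ) * s * (2 / W) := by
    rw [hτ]
    simp only [hy, Mf, PiLp.toLp_apply, Matrix.cons_val_two, Matrix.tail_cons, Matrix.head_cons, hJ]
  set σ := Real.sqrt (a ^ 2 + b ^ 2) with hσ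
  have hσpos : 0 < σ := Real.sqrt_pos.2 hab
  have hσne : σ ≠ 0 := hσpos.ne'
  have hσsq : σ ^ 2 = a ^ 2 + b ^ 2 := Real.sq_sqrt hab.le
  have hρ2 : y 0 ^ 2 + y 1 ^ 2 = (2 / W) ^ 2 * (a ^ 2 + b ^ 2) := by rw [hy0, hy1]; ring
  have hρ2pos : 0 < y 0 ^ 2 + y 1 ^ 2 := by rw [hρ2]; positivity
  have hρ : rho y = 2 / W * σ := by
    unfold rho
    rw [hρ2, Real.sqrt_mul (sq_nonneg _), Real.sqrt_sq (by positivity)]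
  have key : 4 * (a ^ 2 + b ^ 2) + r ^ 2 * (1 - τ) ^ 2 * s ^ 2 = r ^ 2 * ((1 + τ) - (1 - τ) * c) * W := by
    rw [hW]
    linear_combination (-4 : ℝ) * hτr + (r ^ 2 * (1 - τ) ^ 2) * hcs
  have hN : nsq y = r ^ 2 * ((1 + τ) - (1 - τ) * c) / W := by
    have h1 : nsq y = (4 * (a ^ 2 + b ^ 2) + r ^ 2 * (1 - τ) ^ 2 * s ^ 2) / W ^ 2 := by
      unfold nsq
      rw [hy0, hy1, hy2]
      field_simp
      ring
    rw [h1, key]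
    field_simp
  have hNr : r ^ 2 - nsq y = 2 * r ^ 2 * (1 - τ) * c / W := by
    rw [hN]
    field_simp
    rw [hW]
    ring
  have hA : nsq y + r ^ 2 = 2 * r ^ 2 * (1 + τ) / W := by
    rw [hN]
    field_simp
    rw [hW]
    ring
  have hDval : disc r y = (2 * r ^ 2 * (1 - τ) / W) ^ 2 := by
    have h1 : disc r y = 4 * r ^ 4 * (1 - τ) ^ 2 * (c ^ 2 + s ^ 2) / W ^ 2 := by
      unfold disc
      rw [show nsq y - r ^ 2 = -(r ^ 2 - nsq y) by ring, hNr, hy2]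
      field_simp
      ring
    rw [h1, hcs]
    field_simp
    ring
  have hdnn : 0 ≤ 2 * r ^ 2 * (1 - τ) / W := div_nonneg (mul_nonneg (by positivity) h1τ.le) hWpos.le
  have hd : Real.sqrt (disc r y) = 2 * r ^ 2 * (1 - τ) / W := by rw [hDval, Real.sqrt_sq hdnn]
  have hDpos : 0 < disc r y := by
    rw [hDval]
    exact pow_pos (div_pos (mul_pos (by positivity) h1τ) hWpos) 2
  have htf : tf r y = r * τ / σ := by
    unfold tf
    rw [hA, hd, hρ]
    field_simp
    ring
  have hrτ : r ^ 2 * τ = σ ^ 2 := by rw [hσsq, ← hτr]; ring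
  refine ⟨hρ2pos, hDpos, ?_, ?_, ?_, ?_⟩
  · have h1 : af r y = (r ^ 2 * τ) * a / σ ^ 2 := by
      unfold af
      rw [htf, hy0, hρ]
      field_simp
    rw [h1, hrτ]
    field_simp
  · have h1 : bf r y = (r ^ 2 * τ) * b / σ ^ 2 := by
      unfold bf
      rw [htf, hy1, hρ]
      field_simp
    rw [h1, hrτ]
    field_simp
  · unfold cf
    rw [hNr, hd]
    field_simp
  · unfold sf
    rw [hy2, hd]
    field_simp

end Backward

end Summit.CriticalPhenomena.Ising3DConformalLimit.ModularQuarterTurnToroidal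

end
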